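import Mathlib
import Literature.Analysis.FluidPDE.VectorCalculus

/-!
# Rotation covariance of the crux's binders `u` (matched Biot–Savart field) and `T` (tangency defect) — the symmetry behind the
# ROTATION MODE and the phase condition of clause 13-R (crux `Clause13RNearStraightL`, stmt-NavierStokesRegularity-23612; also 23610 / 23321)

Route `FilamentSkeletonRss`, Variant A1R.  In every statement of the `SkeletonJ1*` / `Clause13*` family the objects are let-bound by
`hu : u Z y = Σ_k (Γγ_k/4π) • ∫ ((‖y − Z k σ‖² + κ·Aa k σ)^{3/2})⁻¹ • (Z_k′σ × (y − Z k σ)) dσ` and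
`hT : T Z j τ = W − (⟪W, Z_j′τ⟫/‖Z_j′τ‖²)•Z_j′τ`, `W = u Z (Z j τ) + ½ Z j τ − α e₃ × Z j τ`.
The line card of `rate_bordered_split` (§«Why it might fail») and census memo `CENSUS-23610-side-23612-g16.md` (c4) rest on ONE continuous
symmetry of these binders: rotations about `e₃`.  This file proves it exactly, for any linear isometry `R` of `ℝ³` that preserves the cross
product (`R a × R b = R (a × b)`, i.e. `R ∈ SO(3)`) and fixes `e₃`:

* `deriv_comp_linearIsometryEquiv` — `(R ∘ Z_k)′ σ = R (Z_k′ σ)` (no differentiability hypothesis: both sides are junk `0` together);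
* `biotSavart_rotation_equivariant` — `u (R ∘ Z) (R y) = R (u Z y)` (cross-product preservation, isometry, `R` commutes with the Bochner integral);
* `velocity_rotation_equivariant` — the similarity-frame velocity `W` is equivariant once `R e₃ = e₃`;
* `tangencyDefect_rotation_equivariant` — **`T (R ∘ Z) j τ = R (T Z j τ)`**; hence (`tangencyDefect_rotated_eq_zero`) the whole `R`-orbit of a
  skeleton has zero defect at every station where the skeleton has (clause 8 ⇒ in-ball tangency is rotation invariant): the infinitesimal
  generator of this orbit is the ROTATION MODE `e₃ × X_j` whose normal part is the RATE COLUMN `R_j = P_n(e₃ × X_j)` of 13-R — the in-ball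
  kernel direction that the phase condition `Σ_j ⟪Y_j(c_j), e₃ × X_j(c_j)⟫ = 0` is there to exclude;
* `tangencyDefect_eq_zero_of_tangent` — clause 8 in `T`-language: `v (X j τ) = w•X_j′τ` with `‖X_j′τ‖ = 1` gives `T X j τ = 0` (for ANY
  field `u`; only the binders `hv`, `hT` are used).

Hand `leafhand-ns-filamentskeletonrs-3-g0` (LAND-ONLY); `--supports stmt-NavierStokesRegularity-23612 --as helper`.  HONEST FRAMING: symmetry bookkeeping
for a HYPOTHETICAL filament skeleton on the NEGATIVE side of a MODEL blow-up route; nothing here bears on Navier–Stokes regularity or blow-up.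
-/

noncomputable section

open scoped InnerProductSpace BigOperators
open MeasureTheory
open Literature.Analysis.FluidPDE

namespace Summit.NavierStokesRegularity.NavierStokesRegularity.Theorems.Clause13RotationCovariance
set_option linter.dupNamespace false

/-- `(R ∘ Z)′ σ = R (Z′ σ)` for a linear isometry equivalence `R`, with no differentiability hypothesis (if `Z` is not differentiable at `σ`
neither is `R ∘ Z`, and both sides are `0`). [folklore] -/
theorem deriv_comp_linearIsometryEquiv (R : EuclideanSpace ℝ (Fin 3) ≃ₗᵢ[ℝ] EuclideanSpace ℝ (Fin 3)) (Z : ℝ → EuclideanSpace ℝ (Fin 3))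
    (σ : ℝ) : deriv (fun s => R (Z s)) σ = R (deriv Z σ) := by
  by_cases h : DifferentiableAt ℝ Z σ
  · exact (R.toContinuousLinearEquiv.toContinuousLinearMap.hasFDerivAt.comp_hasDerivAt σ h.hasDerivAt).deriv
  · have h' : ¬ DifferentiableAt ℝ (fun s => R (Z s)) σ := by
      intro hd
      exact h ((R.toContinuousLinearEquiv.comp_differentiableAt_iff).1 hd)
    rw [deriv_zero_of_not_differentiableAt h, deriv_zero_of_not_differentiableAt h', map_zero]

/-- **Rotation equivariance of the matched Biot–Savart binder**: for a cross-product-preserving linear isometry `R`,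
`u (R ∘ Z) (R y) = R (u Z y)`. [folklore] -/
theorem biotSavart_rotation_equivariant {N : ℕ} (R : EuclideanSpace ℝ (Fin 3) ≃ₗᵢ[ℝ] EuclideanSpace ℝ (Fin 3))
    (hRcross : ∀ a b, cross (R a) (R b) = R (cross a b)) {Γ κ : ℝ} {γ : Fin N → ℝ} {Aa : Fin N → ℝ → ℝ}
    {u : (Fin N → ℝ → EuclideanSpace ℝ (Fin 3)) → EuclideanSpace ℝ (Fin 3) → EuclideanSpace ℝ (Fin 3)}
    (hu : ∀ Z y, u Z y = ∑ k, (Γ * γ k / (4 * Real.pi)) • ∫ σ : ℝ,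
      ((‖y - Z k σ‖ ^ 2 + κ * Aa k σ) ^ (3 / 2 : ℝ))⁻¹ • cross (deriv (Z k) σ) (y - Z k σ))
    (Z : Fin N → ℝ → EuclideanSpace ℝ (Fin 3)) (y : EuclideanSpace ℝ (Fin 3)) :
    u (fun k σ => R (Z k σ)) (R y) = R (u Z y) := by
  rw [hu, hu, map_sum]
  refine Finset.sum_congr rfl fun k _ => ?_
  rw [LinearIsometryEquiv.map_smul]
  congr 1
  rw [← LinearIsometryEquiv.coe_toContinuousLinearEquiv, ← ContinuousLinearEquiv.integral_comp_comm]
  refine integral_congr_ae (Filter.Eventually.of_forall fun σ => ?_)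
  simp only [LinearIsometryEquiv.coe_toContinuousLinearEquiv]
  rw [deriv_comp_linearIsometryEquiv R (Z k) σ]
  have hnorm : ‖R y - R (Z k σ)‖ = ‖y - Z k σ‖ := by rw [← map_sub, LinearIsometryEquiv.norm_map]
  rw [hnorm, LinearIsometryEquiv.map_smul, ← hRcross, map_sub]

/-- A cross-product-preserving `R` fixing `e₃` commutes with `e₃ × ·`. [folklore] -/
theorem map_cross_single_two (R : EuclideanSpace ℝ (Fin 3) ≃ₗᵢ[ℝ] EuclideanSpace ℝ (Fin 3))
    (hRcross : ∀ a b, cross (R a) (R b) = R (cross a b)) (hRe : R (EuclideanSpace.single 2 1) = EuclideanSpace.single 2 1)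
    (y : EuclideanSpace ℝ (Fin 3)) :
    R (cross (EuclideanSpace.single 2 1) y) = cross (EuclideanSpace.single 2 1) (R y) := by
  rw [← hRcross, hRe]

/-- **Equivariance of the similarity-frame velocity** `W(Z, y) = u Z y + ½y − α e₃ × y`. [folklore] -/
theorem velocity_rotation_equivariant {N : ℕ} (R : EuclideanSpace ℝ (Fin 3) ≃ₗᵢ[ℝ] EuclideanSpace ℝ (Fin 3))
    (hRcross : ∀ a b, cross (R a) (R b) = R (cross a b)) (hRe : R (EuclideanSpace.single 2 1) = EuclideanSpace.single 2 1)
    {Γ κ α : ℝ} {γ : Fin N → ℝ} {Aa : Fin N → ℝ → ℝ}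
    {u : (Fin N → ℝ → EuclideanSpace ℝ (Fin 3)) → EuclideanSpace ℝ (Fin 3) → EuclideanSpace ℝ (Fin 3)}
    (hu : ∀ Z y, u Z y = ∑ k, (Γ * γ k / (4 * Real.pi)) • ∫ σ : ℝ,
      ((‖y - Z k σ‖ ^ 2 + κ * Aa k σ) ^ (3 / 2 : ℝ))⁻¹ • cross (deriv (Z k) σ) (y - Z k σ))
    (Z : Fin N → ℝ → EuclideanSpace ℝ (Fin 3)) (y : EuclideanSpace ℝ (Fin 3)) :
    u (fun k σ => R (Z k σ)) (R y) + (1 / 2 : ℝ) • R y - α • cross (EuclideanSpace.single 2 1) (R y)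
      = R (u Z y + (1 / 2 : ℝ) • y - α • cross (EuclideanSpace.single 2 1) y) := by
  rw [biotSavart_rotation_equivariant R hRcross hu Z y, map_sub, map_add, LinearIsometryEquiv.map_smul,
    LinearIsometryEquiv.map_smul, map_cross_single_two R hRcross hRe]

/-- **ROTATION COVARIANCE OF THE TANGENCY DEFECT**: `T (R ∘ Z) j τ = R (T Z j τ)` for every cross-product-preserving linear isometry `R`
fixing `e₃` (rotations about the similarity axis), `T` and `u` given by the crux's binders. [folklore] -/
theorem tangencyDefect_rotation_equivariant {N : ℕ} (R : EuclideanSpace ℝ (Fin 3) ≃ₗᵢ[ℝ] EuclideanSpace ℝ (Fin 3))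
    (hRcross : ∀ a b, cross (R a) (R b) = R (cross a b)) (hRe : R (EuclideanSpace.single 2 1) = EuclideanSpace.single 2 1)
    {Γ κ α : ℝ} {γ : Fin N → ℝ} {Aa : Fin N → ℝ → ℝ}
    {u : (Fin N → ℝ → EuclideanSpace ℝ (Fin 3)) → EuclideanSpace ℝ (Fin 3) → EuclideanSpace ℝ (Fin 3)}
    {T : (Fin N → ℝ → EuclideanSpace ℝ (Fin 3)) → Fin N → ℝ → EuclideanSpace ℝ (Fin 3)}
    (hu : ∀ Z y, u Z y = ∑ k, (Γ * γ k / (4 * Real.pi)) • ∫ σ : ℝ,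
      ((‖y - Z k σ‖ ^ 2 + κ * Aa k σ) ^ (3 / 2 : ℝ))⁻¹ • cross (deriv (Z k) σ) (y - Z k σ))
    (hT : ∀ Z j τ, T Z j τ = (u Z (Z j τ) + (1 / 2 : ℝ) • Z j τ - α • cross (EuclideanSpace.single 2 1) (Z j τ))
      - (⟪u Z (Z j τ) + (1 / 2 : ℝ) • Z j τ - α • cross (EuclideanSpace.single 2 1) (Z j τ), deriv (Z j) τ⟫_ℝ
          / ‖deriv (Z j) τ‖ ^ 2) • deriv (Z j) τ)
    (Z : Fin N → ℝ → EuclideanSpace ℝ (Fin 3)) (j : Fin N) (τ : ℝ) :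
    T (fun k σ => R (Z k σ)) j τ = R (T Z j τ) := by
  rw [hT, hT]
  have hW := velocity_rotation_equivariant R hRcross hRe hu Z (Z j τ) (α := α)
  have hd : deriv (fun σ => R (Z j σ)) τ = R (deriv (Z j) τ) := deriv_comp_linearIsometryEquiv R (Z j) τ
  beta_reduce
  rw [hd, hW, LinearIsometryEquiv.inner_map_map, LinearIsometryEquiv.norm_map]
  conv_rhs => rw [map_sub, LinearIsometryEquiv.map_smul]

/-- Hence the `R`-orbit of a skeleton has zero tangency defect wherever the skeleton has: the infinitesimal version is the in-ball
ROTATION MODE `e₃ × X_j` (normal part = the rate column of 13-R). [folklore] -/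
theorem tangencyDefect_rotated_eq_zero {N : ℕ} (R : EuclideanSpace ℝ (Fin 3) ≃ₗᵢ[ℝ] EuclideanSpace ℝ (Fin 3))
    (hRcross : ∀ a b, cross (R a) (R b) = R (cross a b)) (hRe : R (EuclideanSpace.single 2 1) = EuclideanSpace.single 2 1)
    {Γ κ α : ℝ} {γ : Fin N → ℝ} {Aa : Fin N → ℝ → ℝ}
    {u : (Fin N → ℝ → EuclideanSpace ℝ (Fin 3)) → EuclideanSpace ℝ (Fin 3) → EuclideanSpace ℝ (Fin 3)}
    {T : (Fin N → ℝ → EuclideanSpace ℝ (Fin 3)) → Fin N → ℝ → EuclideanSpace ℝ (Fin 3)}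
    (hu : ∀ Z y, u Z y = ∑ k, (Γ * γ k / (4 * Real.pi)) • ∫ σ : ℝ,
      ((‖y - Z k σ‖ ^ 2 + κ * Aa k σ) ^ (3 / 2 : ℝ))⁻¹ • cross (deriv (Z k) σ) (y - Z k σ))
    (hT : ∀ Z j τ, T Z j τ = (u Z (Z j τ) + (1 / 2 : ℝ) • Z j τ - α • cross (EuclideanSpace.single 2 1) (Z j τ))
      - (⟪u Z (Z j τ) + (1 / 2 : ℝ) • Z j τ - α • cross (EuclideanSpace.single 2 1) (Z j τ), deriv (Z j) τ⟫_ℝ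
          / ‖deriv (Z j) τ‖ ^ 2) • deriv (Z j) τ)
    {Z : Fin N → ℝ → EuclideanSpace ℝ (Fin 3)} {j : Fin N} {τ : ℝ} (h0 : T Z j τ = 0) :
    T (fun k σ => R (Z k σ)) j τ = 0 := by
  rw [tangencyDefect_rotation_equivariant R hRcross hRe hu hT Z j τ, h0, map_zero]

/-- **Clause 8 in `T`-language**: if `v (X j τ) = w • X_j′τ` with `‖X_j′τ‖ = 1` and `v y = u X y + ½y − α e₃ × y`, then `T X j τ = 0`. [folklore] -/
theorem tangencyDefect_eq_zero_of_tangent {N : ℕ} {α : ℝ}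
    {u : (Fin N → ℝ → EuclideanSpace ℝ (Fin 3)) → EuclideanSpace ℝ (Fin 3) → EuclideanSpace ℝ (Fin 3)}
    {v : EuclideanSpace ℝ (Fin 3) → EuclideanSpace ℝ (Fin 3)}
    {T : (Fin N → ℝ → EuclideanSpace ℝ (Fin 3)) → Fin N → ℝ → EuclideanSpace ℝ (Fin 3)}
    {X : Fin N → ℝ → EuclideanSpace ℝ (Fin 3)} {w : Fin N → ℝ → ℝ}
    (hv : ∀ y, v y = u X y + (1 / 2 : ℝ) • y - α • cross (EuclideanSpace.single 2 1) y)
    (hT : ∀ Z j τ, T Z j τ = (u Z (Z j τ) + (1 / 2 : ℝ) • Z j τ - α • cross (EuclideanSpace.single 2 1) (Z j τ))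
      - (⟪u Z (Z j τ) + (1 / 2 : ℝ) • Z j τ - α • cross (EuclideanSpace.single 2 1) (Z j τ), deriv (Z j) τ⟫_ℝ
          / ‖deriv (Z j) τ‖ ^ 2) • deriv (Z j) τ)
    (j : Fin N) (τ : ℝ) (hunit : ‖deriv (X j) τ‖ = 1) (htan : v (X j τ) = w j τ • deriv (X j) τ) :
    T X j τ = 0 := by
  have hW : u X (X j τ) + (1 / 2 : ℝ) • X j τ - α • cross (EuclideanSpace.single 2 1) (X j τ) = w j τ • deriv (X j) τ := by
    rw [← hv]; exact htan
  rw [hT, hW, inner_smul_left, real_inner_self_eq_norm_sq, hunit]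
  simp

end Summit.NavierStokesRegularity.NavierStokesRegularity.Theorems.Clause13RotationCovariance

end
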